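import Summits.BirchSwinnertonDyer.BirchSwinnertonDyer.Theorems.Rank1ResidualJetSection6BridgeMin
import HarnessLib

/-!
# Crux `JetchevIrreducibleReadingByName` (item 20165, shared K8-t′ / K9, cell `bsd-potss`), stub S2
# `stub_divisibilityIrredAddv`: bsd-jet's road-K BRIDGE made IMAGE-FREE — the divisibility of derived Heegner
# points from McCallum 1991 Prop. 5.2 FOR THE ROW + «Prop. 6.4 and Thm. 6.3 for the row objects», and its feed
# from Prop. 5.2 in the IRREDUCIBLE reading (seat `bsd-potss-k8t-c4` g8; `--supports 20165`, helper; route-free;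
# nothing booked, no item closed, BSD is not proved by any of this)

WHY. The registered stub S2 of the crux's BC3 skeleton (`Cruxes/JetchevIrreducibleReadingByName/Lines/birth.lean`,
evidence #1 on 20165) is bsd-jet's reading binder `JET.JetchevDivisibilityCarrierNe` (`Rank1ResidualJetDefs.lean`)
with its `p`-adic-TOWER binder replaced by IRREDUCIBILITY of `E[p]` (plus the D-audit guards of the additive-`p`
reading). bsd-jet reduced its three tower-binders K1/K3/K4 to «McCallum Prop. 5.2 (typed Literature fact, tower
binder) + [J] Prop. 6.4 + [J] Thm. 6.3 for the row objects» (`JET.derivedPoint_divisible_of_prop52_of_section6_min`,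
`Rank1ResidualJetSection6BridgeMin.lean`, p47xxxx), over the ABSTRACT §6 kernel
`JET.Section6.tamagawaExponent_le_mInfty_of_coreVertices_min` — which is image-free. In that bridge the image
hypothesis enters at exactly ONE line: the call to McCallum's Prop. 5.2 (Kolyvagin's redefinition of `m_∞`).
This file makes that explicit:

* §1 `derivedPoint_divisible_of_prop52Row_of_section6_min` — the bridge with NO image hypothesis and NO
  arithmetic binder at all: its only inputs are (i) `h52row`, the CONCLUSION of McCallum's Prop. 5.2 for THIS
  row `(W, K, p, Dt, β, ι)` in the weakened form the bridge consumes (for every `r ≥ 1`, every `M_r` and every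
  bound `m'`: a conductor `n ∈ Λ^r` with `m' ≤ M(n)` and `p^{M_r} ∥ P_n` — McCallum's
  `exists_conductor_levelIndex_ge_exactDepth_of_prop52`, row-level), and (ii) `H` = [J] Prop. 6.4 (at `k ≥ 1`,
  `m(c) = m_∞`) and Thm. 6.3 for the row objects, verbatim as in the `_min` bridge. Proof = that bridge's proof
  byte-for-byte (McCallum's `m_∞ := min ⋃_r M_r`-candidates, `hmInf`, `hK` by `c = 1` or by `h52row`, then the
  §6 kernel), with the one Prop. 5.2 call replaced by `h52row`.
* §2 `prop52Row_of_prop52Irred` — `h52row` for a row with `E[p]` IRREDUCIBLE from the displayed statement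
  `h52I` = `McCallum1991.prop52_exists_conductor_kolyvaginClass_order_eq` with its tower binder replaced by
  `W.HasIrreducibleModPGaloisRep p` (McCallum's Prop. 5.2 in the irreducible reading — Jetchev 2008 Rem. 6.2:
  *"the proof of [McCallum] does not need the surjectivity of the Galois representation, but simply … the
  absolute irreducibility"*; a READING, displayed as a binder, nothing asserted), and `prop52Row_of_prop52` —
  the same from the typed tower fact, so bsd-jet's bridge is the tower instance of §1 (bookkeeping).

So, in the kernel: S2 ⟸ {Prop. 5.2 in the irreducible reading} + {Prop. 6.4 + Thm. 6.3 for the row objects};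
the sequel `…DivisibilityCoreVertexBridge.lean` feeds Prop. 6.4 from the irreducible reading of Jetchev's
Prop. 5.3 (core vertices by Čebotarev under absolute irreducibility) using x11b3's `E(K[c])[p] = 0` from
irreducibility, leaving Thm. 6.3 for the row objects — the place where the additive-`p` Selmer condition
(`p ∤ c_p`) and [GZ III (3.1)] at `q ∥ N` live. CONDITIONAL on the displayed binders; nothing asserted.

References: [cite: Jetchev2008, §3.1 item 5, Rem. 6.2, Prop. 6.4, Thm. 6.3 and Proof of Thm. 1.4 (pp. 817, 823–825)]
[cite: McCallumLMS1991, §5 Prop. 5.2 (p. 304), §3 Cor. 3.2] [cite: WZhang2014, Notations (xii)].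
-/

set_option autoImplicit false
-- the Theorems directory repeats the summit name (sibling precedent `KatoDescentPotSupersingularAssembly.lean`)
set_option linter.dupNamespace false

noncomputable section

open scoped Classical

namespace Summit.BirchSwinnertonDyer.BirchSwinnertonDyer.Theorems.JetchevIrreducibleReadingDivisibility

open WeierstrassCurve Literature.NumberTheory.EllipticCurves
  Literature.NumberTheory.EllipticCurves.ModularForms
  Summit.BirchSwinnertonDyer.Rank1Residual.JET

/-! ### §1 The image-free row bridge -/

/-- **[J] Thm. 1.4's divisibility from Prop. 5.2 FOR THE ROW + «Prop. 6.4 and Thm. 6.3 for the row objects»,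
NO image hypothesis.** For `W/ℚ`, a number field `K`, a prime `p`, a frame `(Dt, β, ι)` at level
`N = W.conductorNorm ℤ`, and a number `t`: IF (`h52row`) for every `r ≥ 1`, every least exact depth `M_r` over
`Λ^r` and every bound `m'` there is a conductor `n ∈ Λ^r` (square-free, `r` Kolyvagin prime factors) with
`m' ≤ M(n)` and a datum with `p^{M_r} ∥ P_n` (McCallum 1991 Prop. 5.2 for this row, weakened), and IF (`H`)
[J] Prop. 6.4 (at levels `k ≥ 1`, conductors with `m(c) = m_∞`) and Thm. 6.3 hold for the row objects —
quantified over every depth function `mdiv` with `(u : ℕ∞) ≤ mdiv c ↔` «every derived point of conductor `c`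
is `p^u`-divisible», `m c = mdiv c` if `mdiv c < M(c) := Zhang2014.levelIndex` else `⊤`, and every `mInf` with
`mInf ≤ m c` and Kolyvagin's redefinition — THEN every derived point `P_n`, `n` a square-free product of
Kolyvagin primes of index `≥ s`, `s ≤ t`, is `p^s`-divisible in `E(K[n])`. Proof = bsd-jet's
`JET.derivedPoint_divisible_of_prop52_of_section6_min` byte-for-byte with its one Prop. 5.2 call replaced by
`h52row`. CONDITIONAL on `h52row` and `H`; nothing asserted.
[cite: Jetchev2008, Proof of Thm. 1.4 (p. 825), §3.1 item 5 (p. 817)] [cite: McCallumLMS1991, §5 Prop. 5.2 (p. 304)] -/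
theorem derivedPoint_divisible_of_prop52Row_of_section6_min
    (W : WeierstrassCurve ℚ) [W.IsElliptic] [W.IsGloballyMinimal] [NeZero (W.conductorNorm ℤ)]
    (K : Type) [Field K] [NumberField K] (p : ℕ) [Fact p.Prime]
    (Dt : ModularParametrizationData W (W.conductorNorm ℤ)) (β : ℤ) (ι : K →+* ℂ)
    (h52row : ∀ (r : ℕ), 0 < r → ∀ (Mr : ℕ),
      IsLeast {u : ℕ | ∃ (n : ℕ) (d : KolyvaginHeegnerData Dt β ι n), Squarefree n ∧
          n.primeFactors.card = r ∧
          (∀ ℓ ∈ n.primeFactors, Zhang2014.IsKolyvaginPrime (W.conductorNorm ℤ) W K p ℓ ∧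
            u + 1 ≤ Zhang2014.kolyvaginIndex W p ℓ) ∧
          (∃ Q : (W.baseChange (ringClassField K ι n)).toAffine.Point,
            ((p ^ u : ℕ) : ℤ) • Q = d.derivedPoint) ∧
          ¬ ∃ Q : (W.baseChange (ringClassField K ι n)).toAffine.Point,
            ((p ^ (u + 1) : ℕ) : ℤ) • Q = d.derivedPoint} Mr →
      ∀ (m' : ℕ), ∃ (n : ℕ) (d : KolyvaginHeegnerData Dt β ι n), Squarefree n ∧
        n.primeFactors.card = r ∧
        (∀ ℓ ∈ n.primeFactors, Zhang2014.IsKolyvaginPrime (W.conductorNorm ℤ) W K p ℓ) ∧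
        (m' : ℕ∞) ≤ Zhang2014.levelIndex W p n ∧
        (∃ Q : (W.baseChange (ringClassField K ι n)).toAffine.Point,
          ((p ^ Mr : ℕ) : ℤ) • Q = d.derivedPoint) ∧
        ¬ ∃ Q : (W.baseChange (ringClassField K ι n)).toAffine.Point,
          ((p ^ (Mr + 1) : ℕ) : ℤ) • Q = d.derivedPoint)
    (t : ℕ)
    (H : ∀ (mdiv m : {c : ℕ // Squarefree c ∧ ∀ ℓ ∈ c.primeFactors,
          Zhang2014.IsKolyvaginPrime (W.conductorNorm ℤ) W K p ℓ} → ℕ∞),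
      (∀ c (u : ℕ), (u : ℕ∞) ≤ mdiv c ↔ ∀ d : KolyvaginHeegnerData Dt β ι c.1,
        ∃ Q : (W.baseChange (ringClassField K ι c.1)).toAffine.Point,
          ((p ^ u : ℕ) : ℤ) • Q = d.derivedPoint) →
      (∀ c, m c = if mdiv c < Zhang2014.levelIndex W p c.1 then mdiv c else ⊤) →
      ∀ mInf : ℕ, (∀ c, (mInf : ℕ∞) ≤ m c) →
        (∀ m' : ℕ, ∃ c, (m' : ℕ∞) ≤ Zhang2014.levelIndex W p c.1 ∧ m c = mInf) →
      ∃ Core : ℕ → {c : ℕ // Squarefree c ∧ ∀ ℓ ∈ c.primeFactors,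
          Zhang2014.IsKolyvaginPrime (W.conductorNorm ℤ) W K p ℓ} → Prop,
        (∀ (k : ℕ) c, 1 ≤ k → m c = mInf → (mInf : ℕ∞) + k ≤ Zhang2014.levelIndex W p c.1 →
          ∃ c', Core k c' ∧ (k : ℕ∞) + mInf ≤ Zhang2014.levelIndex W p c'.1 ∧ m c' ≤ mInf) ∧
        (∀ (k : ℕ) c, 1 ≤ k → Core k c → m c = mInf →
          (k : ℕ∞) + mInf ≤ Zhang2014.levelIndex W p c.1 → t < k → mInf < k → t ≤ mInf))
    (s : ℕ) (hs : s ≤ t) (n : ℕ) (d : KolyvaginHeegnerData Dt β ι n) (hn : Squarefree n)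
    (hℓ : ∀ ℓ ∈ n.primeFactors, Zhang2014.IsKolyvaginPrime (W.conductorNorm ℤ) W K p ℓ ∧
      s ≤ Zhang2014.kolyvaginIndex W p ℓ) :
    ∃ Q : (W.baseChange (ringClassField K ι n)).toAffine.Point,
      ((p ^ s : ℕ) : ℤ) • Q = d.derivedPoint := by
  -- the conductor type and the divisibility predicate
  set Λ := {c : ℕ // Squarefree c ∧ ∀ ℓ ∈ c.primeFactors,
    Zhang2014.IsKolyvaginPrime (W.conductorNorm ℤ) W K p ℓ} with hΛ
  let Dv : ∀ c : ℕ, ℕ → Prop := fun c u ↦ ∀ d : KolyvaginHeegnerData Dt β ι c,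
    ∃ Q : (W.baseChange (ringClassField K ι c)).toAffine.Point, ((p ^ u : ℕ) : ℤ) • Q = d.derivedPoint
  have hDv0 : ∀ c, Dv c 0 := fun c d ↦ ⟨d.derivedPoint, by simp⟩
  have hDvmono : ∀ c {u v : ℕ}, v ≤ u → Dv c u → Dv c v :=
    fun c u v huv h d ↦ exists_pow_smul_eq_of_le p huv (h d)
  -- the depth function `m'(c)` and its characterisation
  let mdivN : ℕ → ℕ∞ := fun c ↦
    if h : ∃ u, ¬ Dv c u then ((Nat.find h - 1 : ℕ) : ℕ∞) else ⊤
  have hchar : ∀ (c u : ℕ), (u : ℕ∞) ≤ mdivN c ↔ Dv c u := by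
    intro c u
    by_cases h : ∃ u, ¬ Dv c u
    · have hfind0 : 0 < Nat.find h := by
        rw [Nat.find_pos]
        exact fun h0 ↦ h0 (hDv0 c)
      simp only [mdivN, dif_pos h, ENat.coe_le_coe]
      constructor
      · intro hu
        have hlt : u < Nat.find h := by omega
        have := (Nat.lt_find_iff h u).mp hlt u le_rfl
        simpa using this
      · intro hu
        have hlt : u < Nat.find h := by
          rw [Nat.lt_find_iff]
          intro v hv hnv
          exact hnv (hDvmono c hv hu)
        omega
    · simp only [mdivN, dif_neg h, le_top, true_iff]
      exact not_not.mp (not_exists.mp h u)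
  -- exact-depth witnesses at a finite depth
  have hexact : ∀ (c u : ℕ), mdivN c = u →
      Dv c u ∧ ∃ d : KolyvaginHeegnerData Dt β ι c,
        (∃ Q : (W.baseChange (ringClassField K ι c)).toAffine.Point,
          ((p ^ u : ℕ) : ℤ) • Q = d.derivedPoint) ∧
        ¬ ∃ Q : (W.baseChange (ringClassField K ι c)).toAffine.Point,
          ((p ^ (u + 1) : ℕ) : ℤ) • Q = d.derivedPoint := by
    intro c u hcu
    have hu : Dv c u := (hchar c u).mp (by rw [hcu])
    have hu1 : ¬ Dv c (u + 1) := by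
      rw [← hchar c (u + 1), hcu, ENat.coe_le_coe]
      omega
    obtain ⟨d, hd⟩ := not_forall.mp hu1
    exact ⟨hu, d, hu d, hd⟩
  -- the functions on `Λ`
  let M : Λ → ℕ∞ := fun c ↦ Zhang2014.levelIndex W p c.1
  let mdiv : Λ → ℕ∞ := fun c ↦ mdivN c.1
  let m : Λ → ℕ∞ := fun c ↦ if mdiv c < M c then mdiv c else ⊤
  have hm : ∀ c, mdiv c < M c → m c ≤ mdiv c := fun c h ↦ by
    simp only [m, if_pos h]
    exact le_rfl
  -- the target conductor as an element of `Λ`, and `s ≤ M(n)`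
  let cn : Λ := ⟨n, hn, fun ℓ h ↦ (hℓ ℓ h).1⟩
  have hsM : (s : ℕ∞) ≤ M cn :=
    Zhang2014.natCast_le_levelIndex_iff.mpr fun ℓ h ↦ (hℓ ℓ h).2
  -- it suffices to bound the depth of conductor `n`
  suffices hgoal : (s : ℕ∞) ≤ mdiv cn from ((hchar n s).mp hgoal) d
  by_contra hlt
  rw [not_le] at hlt
  -- `m'(n)` is finite, `= u₀ < s ≤ M(n)`: McCallum's candidate set is non-empty
  obtain ⟨u₀, hu₀⟩ := ENat.ne_top_iff_exists.mp (ne_top_of_lt hlt)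
  -- McCallum's set `⋃_r {u | ∃ c ∈ Λ^r, d : exact depth u, u + 1 ≤ M(ℓ) ∀ ℓ ∣ c}`
  let T : ℕ → Prop := fun u ↦ ∃ (c : ℕ) (d : KolyvaginHeegnerData Dt β ι c), Squarefree c ∧
      (∀ ℓ ∈ c.primeFactors, Zhang2014.IsKolyvaginPrime (W.conductorNorm ℤ) W K p ℓ ∧
        u + 1 ≤ Zhang2014.kolyvaginIndex W p ℓ) ∧
      (∃ Q : (W.baseChange (ringClassField K ι c)).toAffine.Point,
        ((p ^ u : ℕ) : ℤ) • Q = d.derivedPoint) ∧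
      ¬ ∃ Q : (W.baseChange (ringClassField K ι c)).toAffine.Point,
        ((p ^ (u + 1) : ℕ) : ℤ) • Q = d.derivedPoint
  -- membership of every `c ∈ Λ` with `m'(c) < M(c)`
  have hTmem : ∀ (c : Λ) (u : ℕ), mdiv c = u → mdiv c < M c → T u := by
    intro c u hcu hcM
    obtain ⟨-, d', hd', hnd'⟩ := hexact c.1 u hcu
    have hu1 : ((u + 1 : ℕ) : ℕ∞) ≤ M c := by
      rw [hcu] at hcM
      have : (u : ℕ∞) + 1 ≤ M c := (ENat.add_one_le_iff (ENat.coe_ne_top u)).mpr hcM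
      exact_mod_cast this
    exact ⟨c.1, d', c.2.1, fun ℓ h ↦ ⟨c.2.2 ℓ h, (Zhang2014.natCast_le_levelIndex_iff.mp hu1) ℓ h⟩,
      hd', hnd'⟩
  have hT : ∃ u, T u := ⟨u₀, hTmem cn u₀ hu₀.symm (hlt.trans_le hsM)⟩
  -- `m_∞ := min T`
  set mInf : ℕ := Nat.find hT with hmInfdef
  have hmInfT : T mInf := Nat.find_spec hT
  have hmInfmin : ∀ u, T u → mInf ≤ u := fun u hu ↦ Nat.find_min' hT hu
  -- `hmInf : m_∞ ≤ m(c)`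
  have hmInf : ∀ c, (mInf : ℕ∞) ≤ m c := by
    intro c
    by_cases hcM : mdiv c < M c
    · obtain ⟨u, hu⟩ := ENat.ne_top_iff_exists.mp (ne_top_of_lt hcM)
      have : (mInf : ℕ∞) ≤ mdiv c := by
        rw [← hu, ENat.coe_le_coe]
        exact hmInfmin u (hTmem c u hu.symm hcM)
      simp only [m, if_pos hcM]
      exact this
    · simp only [m, if_neg hcM]
      exact le_top
  -- from an exact-depth-`mInf` datum with `mInf + 1 ≤ M(c)`: `m(c) = m_∞`
  have hmeq : ∀ (c : Λ) (d' : KolyvaginHeegnerData Dt β ι c.1),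
      ((mInf + 1 : ℕ) : ℕ∞) ≤ M c →
      (¬ ∃ Q : (W.baseChange (ringClassField K ι c.1)).toAffine.Point,
        ((p ^ (mInf + 1) : ℕ) : ℤ) • Q = d'.derivedPoint) → m c = mInf := by
    intro c d' hMc hnd'
    -- `m'(c) ≤ mInf`
    have hle : mdiv c ≤ mInf := by
      have h1 : ¬ ((mInf + 1 : ℕ) : ℕ∞) ≤ mdiv c := by
        rw [hchar c.1 (mInf + 1)]
        exact fun h ↦ hnd' (h d')
      rw [not_le] at h1
      have h2 : mdiv c < (mInf : ℕ∞) + 1 := by exact_mod_cast h1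
      exact (ENat.lt_add_one_iff (ENat.coe_ne_top mInf)).mp h2
    have hcM : mdiv c < M c := by
      refine lt_of_le_of_lt hle ?_
      have : (mInf : ℕ∞) < (mInf : ℕ∞) + 1 :=
        ENat.lt_add_one_iff (ENat.coe_ne_top mInf) |>.mpr le_rfl
      exact this.trans_le (by exact_mod_cast hMc)
    have hge : (mInf : ℕ∞) ≤ mdiv c := by
      have := hmInf c
      simp only [m, if_pos hcM] at this
      exact this
    simp only [m, if_pos hcM]
    exact le_antisymm hle hge
  -- `hK : ∀ m', ∃ c, m' ≤ M(c) ∧ m(c) = m_∞` — by `c = 1` (`r = 0`) or McCallum Prop. 5.2 (`r ≥ 1`)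
  have hKoly : ∀ m' : ℕ, ∃ c, (m' : ℕ∞) ≤ M c ∧ m c = mInf := by
    intro m'
    obtain ⟨c₀, d₀, hsq₀, hℓ₀, hd₀, hnd₀⟩ := hmInfT
    by_cases hr : c₀.primeFactors.card = 0
    · -- `r = 0`: `c₀ = 1`, `M(1) = ⊤`
      have hc₀ : c₀ = 1 := by
        rcases Nat.primeFactors_eq_empty.mp (Finset.card_eq_zero.mp hr) with h | h
        · exact absurd h hsq₀.ne_zero
        · exact h
      subst hc₀
      let c1 : Λ := ⟨1, squarefree_one, by simp⟩
      have hM1 : M c1 = ⊤ := Zhang2014.levelIndex_one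
      refine ⟨c1, by simp [hM1], hmeq c1 d₀ (by simp [hM1]) hnd₀⟩
    · -- `r ≥ 1`: McCallum Prop. 5.2 at `M := max m' (m_∞ + 1)`
      have hr0 : 0 < c₀.primeFactors.card := Nat.pos_of_ne_zero hr
      have hleast : IsLeast {u : ℕ | ∃ (c : ℕ) (d : KolyvaginHeegnerData Dt β ι c), Squarefree c ∧
          c.primeFactors.card = c₀.primeFactors.card ∧
          (∀ ℓ ∈ c.primeFactors, Zhang2014.IsKolyvaginPrime (W.conductorNorm ℤ) W K p ℓ ∧
            u + 1 ≤ Zhang2014.kolyvaginIndex W p ℓ) ∧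
          (∃ Q : (W.baseChange (ringClassField K ι c)).toAffine.Point,
            ((p ^ u : ℕ) : ℤ) • Q = d.derivedPoint) ∧
          ¬ ∃ Q : (W.baseChange (ringClassField K ι c)).toAffine.Point,
            ((p ^ (u + 1) : ℕ) : ℤ) • Q = d.derivedPoint} mInf :=
        ⟨⟨c₀, d₀, hsq₀, rfl, hℓ₀, hd₀, hnd₀⟩,
          fun u ⟨c, d', hsq, _, hℓ', hd', hnd'⟩ ↦ hmInfmin u ⟨c, d', hsq, hℓ', hd', hnd'⟩⟩
      obtain ⟨c, d', hsq, -, hℓ', hMc, -, hnd'⟩ :=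
        h52row _ hr0 mInf hleast (max m' (mInf + 1))
      let cc : Λ := ⟨c, hsq, hℓ'⟩
      have hMc' : ((max m' (mInf + 1) : ℕ) : ℕ∞) ≤ M cc := hMc
      refine ⟨cc, le_trans (by exact_mod_cast le_max_left m' (mInf + 1)) hMc',
        hmeq cc d' (le_trans (by exact_mod_cast le_max_right m' (mInf + 1)) hMc') hnd'⟩
  -- Prop. 6.4 and Thm. 6.3 for these data
  obtain ⟨Core, h64, h63⟩ := H mdiv m (fun c u ↦ hchar c.1 u) (fun c ↦ rfl) mInf hmInf hKoly
  -- §6 abstract end form (minimal-core-vertex variant)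
  have := Section6.depth_le_mdiv_of_le_mInfty M mdiv m hm mInf hmInf
    (Section6.tamagawaExponent_le_mInfty_of_coreVertices_min M m Core t mInf hmInf hKoly h64 h63)
    s hs cn hsM
  exact absurd this (not_le.mpr hlt)



/-! ### §2 Feeding `h52row`: McCallum Prop. 5.2 in the IRREDUCIBLE reading (and, for bookkeeping, from the tower fact) -/

/-- **`h52row` for a row with `E[p]` IRREDUCIBLE**, from the displayed statement `h52I` = the Literature fact
`McCallum1991.prop52_exists_conductor_kolyvaginClass_order_eq` (McCallum 1991 Prop. 5.2, Kolyvagin's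
redefinition of `m_∞`) with its `p`-adic-tower binder REPLACED by `W.HasIrreducibleModPGaloisRep p` — a READING
(Jetchev 2008 Rem. 6.2: McCallum's proofs use the image only through the spanning of `End_{𝔽_p}(E[p])` by Galois
elements, i.e. absolute irreducibility; for the odd representation `E[p]`, `p ≠ 2`, irreducible ⟺ absolutely
irreducible), displayed as a binder, nothing asserted. Proof: Prop. 5.2 at `M := max m' (M_r + 1)` (McCallum's
`exists_conductor_levelIndex_ge_exactDepth_of_prop52`, five lines).
[cite: McCallumLMS1991, §5 Prop. 5.2 (p. 304)] [cite: Jetchev2008, Rem. 6.2 and proof of Thm. 1.4 (arXiv p0017)] -/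
theorem prop52Row_of_prop52Irred
    (h52I : ∀ (W : WeierstrassCurve ℚ) [W.IsElliptic] [W.IsGloballyMinimal] [NeZero (W.conductorNorm ℤ)],
        ¬ W.HasCM →
        ∀ (K : Type) [Field K] [NumberField K], IsImaginaryQuadratic K →
        NumberField.discr K ≠ -3 → NumberField.discr K ≠ -4 →
        SatisfiesHeegnerHypothesis (W.conductorNorm ℤ) K →
        ∀ (p : ℕ) [Fact p.Prime], p ≠ 2 → W.HasIrreducibleModPGaloisRep p →
        ∀ (Dt : ModularParametrizationData W (W.conductorNorm ℤ)) (β : ℤ) (ι : K →+* ℂ)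
          (d₁ : KolyvaginHeegnerData Dt β ι 1), ¬ IsOfFinAddOrder d₁.derivedPoint →
        ∀ (r : ℕ), 0 < r →
        ∀ (Mr : ℕ),
          IsLeast {u : ℕ | ∃ (n : ℕ) (d : KolyvaginHeegnerData Dt β ι n), Squarefree n ∧
              n.primeFactors.card = r ∧
              (∀ ℓ ∈ n.primeFactors, Zhang2014.IsKolyvaginPrime (W.conductorNorm ℤ) W K p ℓ ∧
                u + 1 ≤ Zhang2014.kolyvaginIndex W p ℓ) ∧
              (∃ Q : (W.baseChange (ringClassField K ι n)).toAffine.Point,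
                ((p ^ u : ℕ) : ℤ) • Q = d.derivedPoint) ∧
              ¬ ∃ Q : (W.baseChange (ringClassField K ι n)).toAffine.Point,
                ((p ^ (u + 1) : ℕ) : ℤ) • Q = d.derivedPoint} Mr →
        ∀ (M : ℕ), Mr < M →
          ∃ (n : ℕ) (d : KolyvaginHeegnerData Dt β ι n), Squarefree n ∧ n.primeFactors.card = r ∧
            (∀ ℓ ∈ n.primeFactors, Zhang2014.IsKolyvaginPrime (W.conductorNorm ℤ) W K p ℓ ∧
              M ≤ Zhang2014.kolyvaginIndex W p ℓ) ∧
            addOrderOf (d.kolyvaginClass (Fact.out : p.Prime) M) = p ^ (M - Mr) ∧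
            (∃ Q : (W.baseChange (ringClassField K ι n)).toAffine.Point,
              ((p ^ Mr : ℕ) : ℤ) • Q = d.derivedPoint) ∧
            ¬ ∃ Q : (W.baseChange (ringClassField K ι n)).toAffine.Point,
              ((p ^ (Mr + 1) : ℕ) : ℤ) • Q = d.derivedPoint)
    (W : WeierstrassCurve ℚ) [W.IsElliptic] [W.IsGloballyMinimal] [NeZero (W.conductorNorm ℤ)]
    (hcm : ¬ W.HasCM) (K : Type) [Field K] [NumberField K] (hK : IsImaginaryQuadratic K)
    (hD3 : NumberField.discr K ≠ -3) (hD4 : NumberField.discr K ≠ -4)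
    (hH : SatisfiesHeegnerHypothesis (W.conductorNorm ℤ) K)
    (p : ℕ) [Fact p.Prime] (hp2 : p ≠ 2) (hirr : W.HasIrreducibleModPGaloisRep p)
    (Dt : ModularParametrizationData W (W.conductorNorm ℤ)) (β : ℤ) (ι : K →+* ℂ)
    (d₁ : KolyvaginHeegnerData Dt β ι 1) (hy : ¬ IsOfFinAddOrder d₁.derivedPoint)
    (r : ℕ) (hr : 0 < r) (Mr : ℕ)
    (hMr : IsLeast {u : ℕ | ∃ (n : ℕ) (d : KolyvaginHeegnerData Dt β ι n), Squarefree n ∧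
        n.primeFactors.card = r ∧
        (∀ ℓ ∈ n.primeFactors, Zhang2014.IsKolyvaginPrime (W.conductorNorm ℤ) W K p ℓ ∧
          u + 1 ≤ Zhang2014.kolyvaginIndex W p ℓ) ∧
        (∃ Q : (W.baseChange (ringClassField K ι n)).toAffine.Point,
          ((p ^ u : ℕ) : ℤ) • Q = d.derivedPoint) ∧
        ¬ ∃ Q : (W.baseChange (ringClassField K ι n)).toAffine.Point,
          ((p ^ (u + 1) : ℕ) : ℤ) • Q = d.derivedPoint} Mr)
    (m' : ℕ) :
    ∃ (n : ℕ) (d : KolyvaginHeegnerData Dt β ι n), Squarefree n ∧ n.primeFactors.card = r ∧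
      (∀ ℓ ∈ n.primeFactors, Zhang2014.IsKolyvaginPrime (W.conductorNorm ℤ) W K p ℓ) ∧
      (m' : ℕ∞) ≤ Zhang2014.levelIndex W p n ∧
      (∃ Q : (W.baseChange (ringClassField K ι n)).toAffine.Point,
        ((p ^ Mr : ℕ) : ℤ) • Q = d.derivedPoint) ∧
      ¬ ∃ Q : (W.baseChange (ringClassField K ι n)).toAffine.Point,
        ((p ^ (Mr + 1) : ℕ) : ℤ) • Q = d.derivedPoint := by
  obtain ⟨n, d, hsq, hcard, hℓ, -, hdiv, hndiv⟩ :=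
    h52I W hcm K hK hD3 hD4 hH p hp2 hirr Dt β ι d₁ hy r hr Mr hMr (max m' (Mr + 1))
      (lt_of_lt_of_le (Nat.lt_succ_self Mr) (le_max_right _ _))
  refine ⟨n, d, hsq, hcard, fun ℓ hℓn ↦ (hℓ ℓ hℓn).1, ?_, hdiv, hndiv⟩
  rw [Zhang2014.natCast_le_levelIndex_iff]
  exact fun ℓ hℓn ↦ (le_max_left _ _).trans (hℓ ℓ hℓn).2

/-- **`h52row` for a row with the `p`-adic tower, from the typed Literature fact** (McCallum 1991 Prop. 5.2
as printed) — so bsd-jet's `JET.derivedPoint_divisible_of_prop52_of_section6_min` is the tower instance of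
§1. Bookkeeping. [cite: McCallumLMS1991, §5 Prop. 5.2 (p. 304)] -/
theorem prop52Row_of_prop52
    (h52 : McCallum1991.prop52_exists_conductor_kolyvaginClass_order_eq)
    (W : WeierstrassCurve ℚ) [W.IsElliptic] [W.IsGloballyMinimal] [NeZero (W.conductorNorm ℤ)]
    (hcm : ¬ W.HasCM) (K : Type) [Field K] [NumberField K] (hK : IsImaginaryQuadratic K)
    (hD3 : NumberField.discr K ≠ -3) (hD4 : NumberField.discr K ≠ -4)
    (hH : SatisfiesHeegnerHypothesis (W.conductorNorm ℤ) K)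
    (p : ℕ) [Fact p.Prime] (hp2 : p ≠ 2) (htower : ∀ n : ℕ, W.HasSurjectiveModNGaloisRep (p ^ n : ℕ))
    (Dt : ModularParametrizationData W (W.conductorNorm ℤ)) (β : ℤ) (ι : K →+* ℂ)
    (d₁ : KolyvaginHeegnerData Dt β ι 1) (hy : ¬ IsOfFinAddOrder d₁.derivedPoint)
    (r : ℕ) (hr : 0 < r) (Mr : ℕ)
    (hMr : IsLeast {u : ℕ | ∃ (n : ℕ) (d : KolyvaginHeegnerData Dt β ι n), Squarefree n ∧
        n.primeFactors.card = r ∧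
        (∀ ℓ ∈ n.primeFactors, Zhang2014.IsKolyvaginPrime (W.conductorNorm ℤ) W K p ℓ ∧
          u + 1 ≤ Zhang2014.kolyvaginIndex W p ℓ) ∧
        (∃ Q : (W.baseChange (ringClassField K ι n)).toAffine.Point,
          ((p ^ u : ℕ) : ℤ) • Q = d.derivedPoint) ∧
        ¬ ∃ Q : (W.baseChange (ringClassField K ι n)).toAffine.Point,
          ((p ^ (u + 1) : ℕ) : ℤ) • Q = d.derivedPoint} Mr)
    (m' : ℕ) :
    ∃ (n : ℕ) (d : KolyvaginHeegnerData Dt β ι n), Squarefree n ∧ n.primeFactors.card = r ∧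
      (∀ ℓ ∈ n.primeFactors, Zhang2014.IsKolyvaginPrime (W.conductorNorm ℤ) W K p ℓ) ∧
      (m' : ℕ∞) ≤ Zhang2014.levelIndex W p n ∧
      (∃ Q : (W.baseChange (ringClassField K ι n)).toAffine.Point,
        ((p ^ Mr : ℕ) : ℤ) • Q = d.derivedPoint) ∧
      ¬ ∃ Q : (W.baseChange (ringClassField K ι n)).toAffine.Point,
        ((p ^ (Mr + 1) : ℕ) : ℤ) • Q = d.derivedPoint :=
  McCallum1991.exists_conductor_levelIndex_ge_exactDepth_of_prop52 h52 W hcm K hK hD3 hD4 hH p hp2 htower Dt β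
    ι d₁ hy r hr Mr hMr m'

end Summit.BirchSwinnertonDyer.BirchSwinnertonDyer.Theorems.JetchevIrreducibleReadingDivisibility

end
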